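import Mathlib
import Summits.Ventures.HodgeRepro2.Tier7.Target

/-!
# Tier 7 — the field (H11b) `center_match` is a NECESSARY condition of `P_T7` (kernel record; Line 2 support)

SEAT: t7-plan-2. Line 2 is WITHDRAWN as a line (STATUS.md l. 14617; census ll. 14617 + 14649 (2)); this module lands
the one piece of its kernel content not already in the tree (the bridge `exists_pure_of_exists` and the Hecke density
`omega_eq_span` are the typer's `Common.Datum.exists_translates_of_pairing_ne_zero'` / `heckeSpan_thetaBase`, landed —
cited, not restated). Cleared as support over the fields by crit-2 (l. 14640 (3)). Imports: Mathlib + the served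
`Tier7.Target` only; no `sorry`, no axiom, no def.

CONTENT. A central element `z` of the Hecke group acting on each summand `omega i` by a scalar `c i` (the shape of the
field `center_scalar`, (H11a)) multiplies every quadrilinear value `⟨a₀ ∧ a₁, a₂ ∧ a₃⟩` with `a_i ∈ omega i` by
`c 0 · c 1 · conj (c 2) · conj (c 3)`, while `∫_X` is `G`-invariant (`intX_act`): if that product is `≠ 1` every such
pairing vanishes, hence every pairing of Hecke translates (`theta_mem` + `omega_irred`). So the matching of the four
central characters, `center_match` (H11b), is a NECESSARY condition of the conclusion of `P_T7` for every datum — a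
field the frozen interface must carry, not the step (the step is the non-vanishing itself). Per-datum statements,
proofs uniform in `D`.

Uses an L-value-free non-vanishing device: NO — these are necessary conditions (vanishing statements), not a
non-vanishing device; they prove nothing about the real `X` beyond the frozen fields.
-/

namespace Summit.Ventures.HodgeRepro2.Tier7.Line2

open Summit.Ventures.HodgeRepro2.Tier7

noncomputable section

variable {K : Type} [Field K] [NumberField K] {E' : Type} [Field E'] [NumberField E']
  {V : Type} [AddCommGroup V] [Module E' V] {HX : Type} [Ring HX] [Algebra ℂ HX]
  {G : Type} [Group G] [MulAction G HX] (D : PeriodDatum K E' V HX G)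

/-- NECESSITY OF (H11b) — kernel-proved over the datum: if a central `z` acts on each `omega i` by the
scalar `c i` (field `center_scalar`) and `c 0 c 1 conj(c 2) conj(c 3) ≠ 1`, the pairing vanishes on EVERY
quadruple from the `omega i`, hence (`theta_mem` + `omega_irred`) on every Hecke translate: the central
characters must match — the field `center_match` is a necessary condition of `P_T7`, not the step. -/
theorem L2_vanish_of_center_mismatch (z : G) (c : Fin 4 → ℂ)
    (hc : ∀ i, ∀ a ∈ D.omega i, z • a = c i • a)
    (hne : c 0 * c 1 * ((starRingEnd ℂ) (c 2) * (starRingEnd ℂ) (c 3)) ≠ 1)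
    (a : Fin 4 → HX) (ha : ∀ i, a i ∈ D.omega i) :
    D.S.L2 (a 0 * a 1) (a 2 * a 3) = 0 := by
  set lam : ℂ := c 0 * c 1 * ((starRingEnd ℂ) (c 2) * (starRingEnd ℂ) (c 3)) with hlam
  set w : HX := a 0 * a 1 * D.S.bar (a 2 * a 3) with hw
  have h1 : z • w = lam • w := by
    rw [hw, D.S.act_mul, D.S.act_mul, hc 0 _ (ha 0), hc 1 _ (ha 1), ← D.S.bar_act, D.S.act_mul,
      hc 2 _ (ha 2), hc 3 _ (ha 3), D.S.bar_mul, D.S.bar_smul, D.S.bar_smul, D.S.bar_mul,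
      smul_mul_smul_comm (c 0) (a 0) (c 1) (a 1),
      smul_mul_smul_comm ((starRingEnd ℂ) (c 2)) (D.S.bar (a 2)) ((starRingEnd ℂ) (c 3)) (D.S.bar (a 3)),
      smul_mul_smul_comm (c 0 * c 1) (a 0 * a 1)]
  have h2 : D.S.intX (z • w) = D.S.intX w := D.S.intX_act z w
  rw [h1, map_smul, smul_eq_mul] at h2
  have h3 : (lam - 1) * D.S.intX w = 0 := by linear_combination h2
  rcases mul_eq_zero.1 h3 with h | h
  · exact absurd (sub_eq_zero.1 h) hne
  · simpa [SurfaceShadow.L2, hw] using h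

/-- The translate form of the necessity: a central scalar mismatch kills `P_T7`'s conclusion for `D`
at every tuple of Hecke translates. -/
theorem not_P_T7_datum_of_center_mismatch (z : G) (c : Fin 4 → ℂ)
    (hc : ∀ i, ∀ a ∈ D.omega i, z • a = c i • a)
    (hne : c 0 * c 1 * ((starRingEnd ℂ) (c 2) * (starRingEnd ℂ) (c 3)) ≠ 1) :
    ∀ g : Fin 4 → G, D.S.L2 (D.fOmegaS g) (D.fOmegaSbar g) = 0 := by
  intro g
  have hmem : ∀ i, (fun i => g i • D.alb (D.e i)) i ∈ D.omega i := fun i =>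
    (D.omega_irred i).2.1 (g i) _ (D.theta_mem i)
  exact L2_vanish_of_center_mismatch D z c hc hne (fun i => g i • D.alb (D.e i)) hmem


/-- The positive form: if the conclusion of `P_T7` holds for `D`, every central scalar action on the four summands
has `c 0 · c 1 · conj (c 2) · conj (c 3) = 1` — exactly the product identity the field `center_match` (H11b) asserts
for the central characters of the `omega i`. -/
theorem center_product_eq_one_of_concl (z : G) (c : Fin 4 → ℂ)
    (hc : ∀ i, ∀ a ∈ D.omega i, z • a = c i • a)
    (h : ∃ g : Fin 4 → G, D.S.L2 (D.fOmegaS g) (D.fOmegaSbar g) ≠ 0) :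
    c 0 * c 1 * ((starRingEnd ℂ) (c 2) * (starRingEnd ℂ) (c 3)) = 1 := by
  by_contra hne
  obtain ⟨g, hg⟩ := h
  exact hg (not_P_T7_datum_of_center_mismatch D z c hc hne g)

end

end Summit.Ventures.HodgeRepro2.Tier7.Line2
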